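import Summits.BirchSwinnertonDyer.BirchSwinnertonDyer.Theorems.CyclotomicUntwistSigmaLineFamilyParallelogram
import Summits.BirchSwinnertonDyer.BirchSwinnertonDyer.Theorems.CyclotomicUntwistSigmaLineFamilyAdmissible
import HarnessLib

/-!
# Route `CyclotomicUntwist`, crux K1 `PSRankOneLowerHalfAtThree` (stmt-BirchSwinnertonDyer-21580):
# the σ-LINE FAMILY — the `p`-DILATED model (one `p`, not `p²`): `(σ_c(pt)/p, p²c)` is a Mazur–Tate pair
# of `(p,0,0,0)⁻¹ • V` for `p ≥ 3`, and THETA AT POINTS of `V` with `‖x‖ > p²` (level `v(z) ≥ 2`)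

Cell `pub/bsd-wall` (D-0145 line `route-BirchSwinnertonDyer-CyclotomicUntwist`), seat `bsd-line-cycu-p1`
g4, lane «σ-LINE FAMILY LAW», file 23. THEOREMS ONLY; helper `--supports` K1 = stmt-BirchSwinnertonDyer-21580.
BSD is not proved by this file and no crux is.

WHY. `…DilatedPair` / `…ThetaAtPoints` / `…Parallelogram` dilate by `u = p²` because only the CRUDE
radius (`σ_c(p²t) ∈ p²t·ℤ_p⟦t⟧`) was available; the price is the depth `‖x‖ > p⁴` (`v(z) ≥ 3`) in the
parallelogram law and the height datum. With Bernardi's sharp radius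
(`…Admissible.isPadicInt_inv_prime_mul_rescale_formalSigma`: `σ_c(pt)/p ∈ ℤ_p⟦t⟧` for `p ≥ 3`) the same
transport works with `u = p`, one level higher:
* `isIntegral_of_scaling_prime` (`aᵢ' = pⁱaᵢ`), `formalSigma_of_scaling_prime`
  (`formalSigma V' (p²c) = p⁻¹·(formalSigma V c)(p·)`), **`isMazurTateSigmaPair_of_scaling_prime`** (`p ≥ 3`);
* `theta_at_points_dilated_prime`; **`theta_at_points_formalSigma_prime`** — for `c ∈ ℤ_p`, `p ≥ 3` and
  `P, Q ∈ V(ℚ_p)` with `‖xᵢ‖ > p²`: `σ_c(z(P+Q))·σ_c(z(P−Q)) = (x₂ − x₁)·σ_c(z(P))²·σ_c(z(Q))²`.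

References: Mazur–Tate 1991 §3; Bernardi 1981 §1; Mazur–Stein–Tate 2006 §1–2. [cite: MazurTate1991, Thm. 3.1]
[cite: MazurSteinTate2006, Thm. 1.3]
-/

set_option autoImplicit false
-- single-conjunct summit: `Summit.BirchSwinnertonDyer.BirchSwinnertonDyer.…` repeats the name by design
set_option linter.dupNamespace false

noncomputable section

open scoped Classical

open PowerSeries WeierstrassCurve Literature.NumberTheory.EllipticCurves Literature.RingTheory.FormalGroups
  Summit.BirchSwinnertonDyer.BirchSwinnertonDyer.Theorems.PSSigmaLineFamily
  Summit.BirchSwinnertonDyer.BirchSwinnertonDyer.Theorems.PSSigmaLineFamilyEvaluation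
  Summit.BirchSwinnertonDyer.BirchSwinnertonDyer.Theorems.PSSigmaLineFamilyDilatedPair
  Summit.BirchSwinnertonDyer.BirchSwinnertonDyer.Theorems.PSSigmaLineFamilyThetaAtPoints
  Summit.BirchSwinnertonDyer.BirchSwinnertonDyer.Theorems.PSSigmaLineFamilyAdmissible

namespace Summit.BirchSwinnertonDyer.BirchSwinnertonDyer.Theorems.PSSigmaLineFamilyPrimeDilation

variable {p : ℕ} [Fact p.Prime]

/-! ### §1 The `p`-dilated model and its Mazur–Tate pair -/

section Dilated

variable (V V' : WeierstrassCurve ℚ_[p]) (vc : VariableChange ℚ_[p]) [V.IsIntegral ℤ_[p]]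

/-- **The `p`-dilated model is `p`-integral** (`aᵢ' = pⁱaᵢ`). [folklore] -/
theorem isIntegral_of_scaling_prime (hu : (vc.u : ℚ_[p]) = (p : ℚ_[p])) (hr : vc.r = 0) (hs : vc.s = 0)
    (ht : vc.t = 0) (hV : vc • V' = V) : V'.IsIntegral ℤ_[p] := by
  obtain ⟨h₁, h₂, h₃, h₄, h₆⟩ := coeffs_of_scaling V V' vc hr hs ht hV
  obtain ⟨n₁, n₂, n₃, n₄, n₆⟩ := V.norm_coeffs_le_one
  have hp : ‖(p : ℚ_[p])‖ ≤ 1 := by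
    rw [Padic.norm_p]; exact inv_le_one_of_one_le₀ (by exact_mod_cast (Fact.out : p.Prime).one_le)
  have hpk : ∀ k : ℕ, ‖(p : ℚ_[p]) ^ k‖ ≤ 1 := fun k => by
    rw [norm_pow]; exact pow_le_one₀ (norm_nonneg _) hp
  have mem : ∀ {a : ℚ_[p]} (k : ℕ), ‖a‖ ≤ 1 → (p : ℚ_[p]) ^ k * a ∈ PadicInt.subring p := by
    intro a k ha
    rw [PadicInt.mem_subring_iff, norm_mul]
    calc ‖(p : ℚ_[p]) ^ k‖ * ‖a‖ ≤ 1 * 1 := by gcongr; exact hpk k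
      _ = 1 := one_mul _
  refine isIntegral_of_mem_subring V' ?_ ?_ ?_ ?_ ?_
  · rw [h₁, hu, ← pow_one (p : ℚ_[p])]; exact mem 1 n₁
  · rw [h₂, hu]; exact mem 2 n₂
  · rw [h₃, hu]; exact mem 3 n₃
  · rw [h₄, hu]; exact mem 4 n₄
  · rw [h₆, hu]; exact mem 6 n₆

omit [V.IsIntegral ℤ_[p]] in
/-- **The `p`-dilated family IS the family of the `p`-dilated model**: for every `c`,
`formalSigma V' (p²c) = p⁻¹·(formalSigma V c)(p·)` (`θ(z) = pz`, `c' = u²c`). [Mazur–Tate 1991, §3]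
[cite: MazurSteinTate2006, Thm. 1.3] -/
theorem formalSigma_of_scaling_prime (hu : (vc.u : ℚ_[p]) = (p : ℚ_[p])) (hr : vc.r = 0) (hs : vc.s = 0)
    (ht : vc.t = 0) (hV : vc • V' = V) (c : ℚ_[p]) :
    V'.formalSigma ((p : ℚ_[p]) ^ 2 * c) = C (((p : ℚ_[p]))⁻¹) * rescale (p : ℚ_[p]) (V.formalSigma c) := by
  have hp0 : (p : ℚ_[p]) ≠ 0 := by exact_mod_cast (Fact.out : p.Prime).ne_zero
  have h0 := constantCoeff_formalSigma V c
  have h1 := coeff_one_formalSigma V c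
  have hodd : (vc • V').IsFormallyOdd (V.formalSigma c) := by rw [hV]; exact isFormallyOdd_formalSigma V c
  have hODE : (vc • V').SatisfiesSigmaODE (V.formalSigma c) c := by
    rw [hV]; exact satisfiesSigmaODE_formalSigma V c
  have hodd' := hodd.variableChange_subst ((vc.u⁻¹ : ℚ_[p]ˣ) : ℚ_[p])
  have hODE' := SatisfiesSigmaODE.variableChange_subst (V := V') (vc := vc) h0 h1 hODE
  have huinv : ((vc.u⁻¹ : ℚ_[p]ˣ) : ℚ_[p]) = ((p : ℚ_[p]))⁻¹ := by
    rw [Units.val_inv_eq_inv_val, hu]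
  rw [subst_formalVariableChange_of_scaling V' vc hr hs ht, hu, huinv] at hodd' hODE'
  rw [hr, sub_zero] at hODE'
  have h0' : constantCoeff (C (((p : ℚ_[p]))⁻¹) * rescale (p : ℚ_[p]) (V.formalSigma c)) = 0 := by
    rw [map_mul, ← coeff_zero_eq_constantCoeff_apply (rescale _ _), coeff_rescale, pow_zero, one_mul,
      coeff_zero_eq_constantCoeff_apply, h0, mul_zero]
  have h1' : coeff 1 (C (((p : ℚ_[p]))⁻¹) * rescale (p : ℚ_[p]) (V.formalSigma c)) = 1 := by
    rw [coeff_C_mul, coeff_rescale, pow_one, h1, mul_one, inv_mul_cancel₀ hp0]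
  exact (eq_formalSigma h0' h1' hodd' hODE').symm

/-- **THE `p`-DILATED MAZUR–TATE PAIR (`p ≥ 3`)**: for a `p`-integral `V/ℚ_p` (any reduction), a model
`V'` with `(p, 0, 0, 0) • V' = V` and `c ∈ ℤ_p`, the transported sigma function `σ' = p⁻¹·σ_c(pz')` with
`c' = p²c` is a Mazur–Tate sigma pair of `V'` — integrality is Bernardi's sharp radius
(`isPadicInt_inv_prime_mul_rescale_formalSigma`). [Mazur–Tate 1991, Thm. 3.1; Bernardi 1981, §1]
[cite: MazurTate1991, Thm. 3.1] [cite: MazurSteinTate2006, Thm. 1.3] -/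
theorem isMazurTateSigmaPair_of_scaling_prime (hp : 3 ≤ p) (hu : (vc.u : ℚ_[p]) = (p : ℚ_[p]))
    (hr : vc.r = 0) (hs : vc.s = 0) (ht : vc.t = 0) (hV : vc • V' = V) {c : ℚ_[p]} (hc : ‖c‖ ≤ 1) :
    V'.IsMazurTateSigmaPair (V'.formalSigma ((p : ℚ_[p]) ^ 2 * c)) ((p : ℚ_[p]) ^ 2 * c) := by
  have hp1 : ‖(p : ℚ_[p])‖ ≤ 1 := by
    rw [Padic.norm_p]; exact inv_le_one_of_one_le₀ (by exact_mod_cast (Fact.out : p.Prime).one_le)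
  have hint : IsPadicInt (V'.formalSigma ((p : ℚ_[p]) ^ 2 * c)) := by
    rw [formalSigma_of_scaling_prime V V' vc hu hr hs ht hV c]
    exact isPadicInt_inv_prime_mul_rescale_formalSigma V hp hc
  refine ⟨constantCoeff_formalSigma V' _, coeff_one_formalSigma V' _, isPadicInt_iff_coeff.mp hint, ?_,
    isFormallyOdd_formalSigma V' _, satisfiesSigmaODE_formalSigma V' _⟩
  rw [norm_mul, norm_pow]
  calc ‖(p : ℚ_[p])‖ ^ 2 * ‖c‖ ≤ 1 ^ 2 * 1 := by gcongr
    _ = 1 := by norm_num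

omit [V.IsIntegral ℤ_[p]] in
/-- **Existence of the `p`-dilated model**: `V' := (p⁻¹, 0, 0, 0) • V`. [Silverman AEC III.1] [folklore] -/
theorem exists_scaling_prime :
    ∃ (V' : WeierstrassCurve ℚ_[p]) (vc : VariableChange ℚ_[p]),
      (vc.u : ℚ_[p]) = (p : ℚ_[p]) ∧ vc.r = 0 ∧ vc.s = 0 ∧ vc.t = 0 ∧ vc • V' = V := by
  have hp0 : (p : ℚ_[p]) ≠ 0 := by exact_mod_cast (Fact.out : p.Prime).ne_zero
  set U : ℚ_[p]ˣ := Units.mk0 (p : ℚ_[p]) hp0 with hU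
  refine ⟨(⟨U⁻¹, 0, 0, 0⟩ : VariableChange ℚ_[p]) • V, ⟨U, 0, 0, 0⟩, by rw [hU, Units.val_mk0], rfl, rfl, rfl, ?_⟩
  rw [← mul_smul]
  have h1 : ((⟨U, 0, 0, 0⟩ : VariableChange ℚ_[p]) * ⟨U⁻¹, 0, 0, 0⟩) = 1 := by
    rw [VariableChange.mul_def, VariableChange.one_def]
    congr 1 <;> simp
  rw [h1, one_smul]

end Dilated

/-! ### §2 Theta at points of `V` with `‖x‖ > p²` -/

section Theta

variable (V : WeierstrassCurve ℚ_[p]) [V.IsElliptic] [V.IsIntegral ℤ_[p]]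

/-- Theta at points of the `p`-dilated model for the member `p⁻¹σ_c(p·)` (`p ≥ 3`). [cite: MazurTate1991, Thm. 3.1] -/
theorem theta_at_points_dilated_prime (hp : 3 ≤ p) (V' : WeierstrassCurve ℚ_[p]) (vc : VariableChange ℚ_[p])
    (hu : (vc.u : ℚ_[p]) = (p : ℚ_[p])) (hr : vc.r = 0) (hs : vc.s = 0) (ht : vc.t = 0) (hV : vc • V' = V)
    {c : ℚ_[p]} (hc : ‖c‖ ≤ 1)
    {x₁ y₁ x₂ y₂ : ℚ_[p]} (h₁ : V'.toAffine.Nonsingular x₁ y₁) (h₂ : V'.toAffine.Nonsingular x₂ y₂)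
    (hx₁ : 1 < ‖x₁‖) (hx₂ : 1 < ‖x₂‖) :
    padicEval (V'.formalSigma ((p : ℚ_[p]) ^ 2 * c)) (V'.formalParameter (.some x₁ y₁ h₁ + .some x₂ y₂ h₂)) *
        padicEval (V'.formalSigma ((p : ℚ_[p]) ^ 2 * c)) (V'.formalParameter (.some x₁ y₁ h₁ - .some x₂ y₂ h₂)) =
      (x₂ - x₁) * padicEval (V'.formalSigma ((p : ℚ_[p]) ^ 2 * c)) (-x₁ / y₁) ^ 2 *
        padicEval (V'.formalSigma ((p : ℚ_[p]) ^ 2 * c)) (-x₂ / y₂) ^ 2 := by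
  haveI : V'.IsElliptic := isElliptic_of_smul_eq V V' vc hV
  haveI : V'.IsIntegral ℤ_[p] := isIntegral_of_scaling_prime V V' vc hu hr hs ht hV
  exact theta_at_points_of_isMazurTateSigmaPair V'
    (isMazurTateSigmaPair_of_scaling_prime V V' vc hp hu hr hs ht hV hc) h₁ h₂ hx₁ hx₂

/-- **THETA AT POINTS WITH `‖x‖ > p²`, every member (`p ≥ 3`).** For a `p`-integral elliptic `V/ℚ_p`,
`c ∈ ℤ_p`, and `P = (x₁,y₁)`, `Q = (x₂,y₂) ∈ V(ℚ_p)` with `‖xᵢ‖ > p²` (`v_p(z) ≥ 2`):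
`σ_c(z(P+Q))·σ_c(z(P−Q)) = (x₂ − x₁)·σ_c(z(P))²·σ_c(z(Q))²`. (One level higher than
`…Parallelogram.theta_at_points_formalSigma`; same proof with the `p`-dilation.) [Mazur–Tate 1991, Thm. 3.1;
Bernardi 1981, §1] [cite: MazurTate1991, Thm. 3.1] -/
theorem theta_at_points_formalSigma_prime (hp : 3 ≤ p) {c : ℚ_[p]} (hc : ‖c‖ ≤ 1) {x₁ y₁ x₂ y₂ : ℚ_[p]}
    (h₁ : V.toAffine.Nonsingular x₁ y₁) (h₂ : V.toAffine.Nonsingular x₂ y₂)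
    (hx₁ : (p : ℝ) ^ 2 < ‖x₁‖) (hx₂ : (p : ℝ) ^ 2 < ‖x₂‖) :
    padicEval (V.formalSigma c) (V.formalParameter (.some x₁ y₁ h₁ + .some x₂ y₂ h₂)) *
        padicEval (V.formalSigma c) (V.formalParameter (.some x₁ y₁ h₁ - .some x₂ y₂ h₂)) =
      (x₂ - x₁) * padicEval (V.formalSigma c) (-x₁ / y₁) ^ 2 * padicEval (V.formalSigma c) (-x₂ / y₂) ^ 2 := by
  have hpp : p.Prime := Fact.out
  have hp0 : (p : ℚ_[p]) ≠ 0 := by exact_mod_cast hpp.ne_zero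
  set U : ℚ_[p]ˣ := Units.mk0 (p : ℚ_[p]) hp0 with hU
  set dil : VariableChange ℚ_[p] := ⟨U⁻¹, 0, 0, 0⟩ with hdil
  set vc : VariableChange ℚ_[p] := ⟨U, 0, 0, 0⟩ with hvc
  set V' : WeierstrassCurve ℚ_[p] := dil • V with hV'
  have hV : vc • V' = V := by
    rw [hV', ← mul_smul]
    have h1 : vc * dil = 1 := by
      rw [hvc, hdil, VariableChange.mul_def, VariableChange.one_def]
      congr 1 <;> simp
    rw [h1, one_smul]
  have hu : (vc.u : ℚ_[p]) = (p : ℚ_[p]) := by rw [hvc]; exact Units.val_mk0 hp0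
  -- the points on `V'`
  have hX : ∀ x : ℚ_[p], dil.toX x = (p : ℚ_[p]) ^ 2 * x := fun x => by
    rw [VariableChange.toX_def, hdil]
    simp only [inv_inv, sub_zero]
    rw [hU, Units.val_mk0]
  have hY : ∀ x y : ℚ_[p], dil.toY x y = (p : ℚ_[p]) ^ 3 * y := fun x y => by
    rw [VariableChange.toY_def, hdil]
    simp only [inv_inv, sub_zero, zero_mul]
    rw [hU, Units.val_mk0]
  have h₁' : V'.toAffine.Nonsingular (dil.toX x₁) (dil.toY x₁ y₁) := (VariableChange.nonsingular_iff V dil x₁ y₁).mpr h₁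
  have h₂' : V'.toAffine.Nonsingular (dil.toX x₂) (dil.toY x₂ y₂) := (VariableChange.nonsingular_iff V dil x₂ y₂).mpr h₂
  have hp2n : ‖(p : ℚ_[p]) ^ 2‖ = ((p : ℝ) ^ 2)⁻¹ := by rw [norm_pow, Padic.norm_p, inv_pow]
  have hpR : (0 : ℝ) < (p : ℝ) ^ 2 := by have := hpp.pos; positivity
  have hx₁' : 1 < ‖dil.toX x₁‖ := by
    rw [hX, norm_mul, hp2n]
    rwa [inv_mul_eq_div, one_lt_div hpR]
  have hx₂' : 1 < ‖dil.toX x₂‖ := by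
    rw [hX, norm_mul, hp2n]
    rwa [inv_mul_eq_div, one_lt_div hpR]
  have hθ := theta_at_points_dilated_prime V hp V' vc hu rfl rfl rfl hV hc h₁' h₂' hx₁' hx₂'
  -- the point map `V(ℚ_p) → V'(ℚ_p)` and the parameters
  set φ := VariableChange.pointEquiv V dil with hφ
  have hφP : φ (.some x₁ y₁ h₁) = .some (dil.toX x₁) (dil.toY x₁ y₁) h₁' := VariableChange.pointEquiv_some V dil h₁
  have hφQ : φ (.some x₂ y₂ h₂) = .some (dil.toX x₂) (dil.toY x₂ y₂) h₂' := VariableChange.pointEquiv_some V dil h₂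
  have hparam : ∀ R : V.toAffine.Point, V'.formalParameter (φ R) = ((p : ℚ_[p]))⁻¹ * V.formalParameter R := by
    intro R
    rcases R with _ | ⟨x, y, h⟩
    · change V'.formalParameter (φ 0) = ((p : ℚ_[p]))⁻¹ * V.formalParameter 0
      rw [map_zero]
      change (0 : ℚ_[p]) = ((p : ℚ_[p]))⁻¹ * 0
      rw [mul_zero]
    · rw [VariableChange.pointEquiv_some V dil h]
      show -(dil.toX x) / (dil.toY x y) = ((p : ℚ_[p]))⁻¹ * (-x / y)
      rw [hX, hY]
      rcases eq_or_ne y 0 with hy | hy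
      · rw [hy, mul_zero, div_zero, div_zero, mul_zero]
      · field_simp
  have hsum : (.some (dil.toX x₁) (dil.toY x₁ y₁) h₁' : V'.toAffine.Point) + .some (dil.toX x₂) (dil.toY x₂ y₂) h₂' =
      φ (.some x₁ y₁ h₁ + .some x₂ y₂ h₂) := by rw [map_add, hφP, hφQ]
  have hdiff : (.some (dil.toX x₁) (dil.toY x₁ y₁) h₁' : V'.toAffine.Point) - .some (dil.toX x₂) (dil.toY x₂ y₂) h₂' =
      φ (.some x₁ y₁ h₁ - .some x₂ y₂ h₂) := by rw [map_sub, hφP, hφQ]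
  -- the member of the dilated family, evaluated
  have hσ' : ∀ z : ℚ_[p], padicEval (V'.formalSigma ((p : ℚ_[p]) ^ 2 * c)) (((p : ℚ_[p]))⁻¹ * z) =
      ((p : ℚ_[p]))⁻¹ * padicEval (V.formalSigma c) z := by
    intro z
    rw [formalSigma_of_scaling_prime V V' vc hu rfl rfl rfl hV c, padicEval_C_mul',
      ← padicEval_mul_eq_padicEval_rescale, mul_inv_cancel_left₀ hp0]
  have hz₁ : -(dil.toX x₁) / dil.toY x₁ y₁ = ((p : ℚ_[p]))⁻¹ * (-x₁ / y₁) := by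
    have := hparam (.some x₁ y₁ h₁); rwa [hφP] at this
  have hz₂ : -(dil.toX x₂) / dil.toY x₂ y₂ = ((p : ℚ_[p]))⁻¹ * (-x₂ / y₂) := by
    have := hparam (.some x₂ y₂ h₂); rwa [hφQ] at this
  rw [hsum, hdiff, hparam, hparam, hz₁, hz₂, hσ', hσ', hσ', hσ', hX, hX] at hθ
  -- cancel the powers of `p`
  have hq : ((p : ℚ_[p]))⁻¹ ≠ 0 := inv_ne_zero hp0
  have e : (p : ℚ_[p]) ^ 2 * ((p : ℚ_[p]))⁻¹ ^ 2 = 1 := by field_simp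
  have key : ((p : ℚ_[p]))⁻¹ ^ 2 *
      (padicEval (V.formalSigma c) (V.formalParameter (.some x₁ y₁ h₁ + .some x₂ y₂ h₂)) *
        padicEval (V.formalSigma c) (V.formalParameter (.some x₁ y₁ h₁ - .some x₂ y₂ h₂))) =
      ((p : ℚ_[p]))⁻¹ ^ 2 *
        ((x₂ - x₁) * padicEval (V.formalSigma c) (-x₁ / y₁) ^ 2 * padicEval (V.formalSigma c) (-x₂ / y₂) ^ 2) := by
    linear_combination hθ + (((p : ℚ_[p]))⁻¹ ^ 2 *
      ((x₂ - x₁) * padicEval (V.formalSigma c) (-x₁ / y₁) ^ 2 * padicEval (V.formalSigma c) (-x₂ / y₂) ^ 2)) * e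
  exact mul_left_cancel₀ (pow_ne_zero 2 hq) key

end Theta

end Summit.BirchSwinnertonDyer.BirchSwinnertonDyer.Theorems.PSSigmaLineFamilyPrimeDilation

end
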